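import Mathlib.LinearAlgebra.Dual.Lemmas
import Mathlib.LinearAlgebra.Contraction
import Summits.Langlands.Langlands.Theorems.IrreducibilityBySelfDualityReciprocityUpToIrreducibilityRStringDefs
import HarnessLib

/-!
# Stub G1 `stub_finrank_invariants_tprod_eq_finrank_homWD_dual` for line `Sketch`
# (crux stmt-Langlands-17925 `IrreducibilityBySelfDuality.ReciprocityUpToIrreducibilityR`,
# registered sub-goal toward stub S-17a-B, Henniart 2002 Thm 1.7 (a), Galois side)

**The Weil–Deligne invariants of `σ ⊗ τ` are `Hom_WD(τ^∨, σ)`** (dimension form).  Under the linear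
isomorphism `Θ : V ⊗ W ≃ Hom(W^*, V)`, `Θ (v ⊗ w) = (f ↦ f w • v)` (Mathlib `dualTensorHomEquiv`
composed with `W ≃ W^{**}`, `Module.evalEquiv`), an elementary tensor of operators `A ⊗ B` becomes
`φ ↦ A ∘ φ ∘ Bᵀ`.  Hence the diagonal action `ρ_σ(g) ⊗ ρ_τ(g)` of `σ.tprod τ` becomes
`φ ↦ ρ_σ(g) ∘ φ ∘ ρ_τ(g)ᵀ = ρ_σ(g) ∘ φ ∘ ρ_τ^∨(g⁻¹)` (the tree's contragredient:
`ρ^∨(g) = ρ(g⁻¹)ᵀ`), and the monodromy `N_σ ⊗ 1 + 1 ⊗ N_τ` becomes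
`φ ↦ N_σ ∘ φ + φ ∘ N_τᵀ = N_σ ∘ φ - φ ∘ N_τ^∨` (`N^∨ = -Nᵀ`).  So `x` is fixed by `W_F` iff `Θ x`
intertwines `ρ_τ^∨` and `ρ_σ`, and `N x = 0` iff `Θ x ∘ N_τ^∨ = N_σ ∘ Θ x`: `Θ` maps
`ker N ⊓ (V ⊗ W)^{W_F}` onto the subspace `homWD (τ.dual) σ`, and the dimensions agree
(`LinearEquiv.finrank_map_eq`).  Ref: Deligne, Antwerp II, LNM 349 (1973), §8.1–8.4;
Tate, Corvallis 1979, (4.1.6).  No definitions, no named facts.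
-/

noncomputable section

set_option linter.dupNamespace false

open scoped TensorProduct
open Module
open Literature.NumberTheory.Automorphic Literature.NumberTheory.GaloisRepresentations
open Literature.NumberTheory.GaloisRepresentations.WeilGroup
open Literature.NumberTheory.GaloisRepresentations.IsNonarchimedeanLocalField

namespace Summit.Langlands.Langlands.Theorems.ReciprocityUpToIrreducibilityR

/-- **`V ⊗ W ≃ Hom(W^*, V)`** for `W` finite-dimensional: a linear isomorphism `Θ` with
`Θ (v ⊗ w) f = f w • v` (Mathlib `dualTensorHomEquiv` after `W ≃ W^{**}`). [folklore] -/
theorem exists_tensorEquivHomDual (V : Type*) [AddCommGroup V] [Module ℂ V]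
    (W : Type*) [AddCommGroup W] [Module ℂ W] [FiniteDimensional ℂ W] :
    ∃ Θ : V ⊗[ℂ] W ≃ₗ[ℂ] (Module.Dual ℂ W →ₗ[ℂ] V),
      ∀ (v : V) (w : W) (f : Module.Dual ℂ W), Θ (v ⊗ₜ w) f = f w • v :=
  ⟨(TensorProduct.comm ℂ V W).trans
      ((TensorProduct.congr (Module.evalEquiv ℂ W) (LinearEquiv.refl ℂ V)).trans
        (dualTensorHomEquiv ℂ (Module.Dual ℂ W) V)),
    fun v w f => by simp [dualTensorHomEquiv]⟩

/-- Under `Θ : V ⊗ W ≃ Hom(W^*, V)`, the operator `A ⊗ B` becomes `φ ↦ A ∘ φ ∘ Bᵀ`. [folklore] -/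
theorem tensorEquivHomDual_map {V : Type*} [AddCommGroup V] [Module ℂ V]
    {W : Type*} [AddCommGroup W] [Module ℂ W]
    (Θ : V ⊗[ℂ] W ≃ₗ[ℂ] (Module.Dual ℂ W →ₗ[ℂ] V))
    (hΘ : ∀ (v : V) (w : W) (f : Module.Dual ℂ W), Θ (v ⊗ₜ w) f = f w • v)
    (A : V →ₗ[ℂ] V) (B : W →ₗ[ℂ] W) (x : V ⊗[ℂ] W) :
    Θ (TensorProduct.map A B x) = A ∘ₗ Θ x ∘ₗ B.dualMap := by
  induction x using TensorProduct.induction_on with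
  | zero => simp
  | tmul v w =>
    rw [TensorProduct.map_tmul]
    ext f
    simp [hΘ, LinearMap.dualMap_apply]
  | add x y hx hy => simp only [map_add, hx, hy, LinearMap.add_comp, LinearMap.comp_add]

/-- `ρ(g)ᵀ ∘ ρ(g⁻¹)ᵀ = id` for a representation `ρ`. [folklore] -/
theorem dualMap_comp_dualMap_inv {G : Type*} [Group G] {W : Type*} [AddCommGroup W] [Module ℂ W]
    (ρ : Representation ℂ G W) (g : G) :
    (ρ g).dualMap ∘ₗ (ρ g⁻¹).dualMap = LinearMap.id := by
  rw [LinearMap.dualMap_comp_dualMap, ← Module.End.mul_eq_comp, ← map_mul, inv_mul_cancel,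
    map_one, Module.End.one_eq_id, LinearMap.dualMap_id]

/-- `ρ(g⁻¹)ᵀ ∘ ρ(g)ᵀ = id` for a representation `ρ`. [folklore] -/
theorem dualMap_inv_comp_dualMap {G : Type*} [Group G] {W : Type*} [AddCommGroup W] [Module ℂ W]
    (ρ : Representation ℂ G W) (g : G) :
    (ρ g⁻¹).dualMap ∘ₗ (ρ g).dualMap = LinearMap.id := by
  rw [LinearMap.dualMap_comp_dualMap, ← Module.End.mul_eq_comp, ← map_mul, mul_inv_cancel,
    map_one, Module.End.one_eq_id, LinearMap.dualMap_id]

/-- **Invariance ↔ intertwining.**  `A ∘ φ ∘ ρ(g)ᵀ = φ` iff `φ ∘ ρ(g⁻¹)ᵀ = A ∘ φ`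
(compose with the inverse transpose). [folklore] -/
theorem comp_comp_dualMap_eq_iff {G : Type*} [Group G] {V : Type*} [AddCommGroup V] [Module ℂ V]
    {W : Type*} [AddCommGroup W] [Module ℂ W] (ρ : Representation ℂ G W) (g : G)
    (A : V →ₗ[ℂ] V) (φ : Module.Dual ℂ W →ₗ[ℂ] V) :
    A ∘ₗ φ ∘ₗ (ρ g).dualMap = φ ↔ φ ∘ₗ (ρ g⁻¹).dualMap = A ∘ₗ φ := by
  constructor
  · intro h
    conv_lhs => rw [← h]
    rw [LinearMap.comp_assoc, LinearMap.comp_assoc, dualMap_comp_dualMap_inv, LinearMap.comp_id]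
  · intro h
    rw [← LinearMap.comp_assoc, ← h, LinearMap.comp_assoc, dualMap_inv_comp_dualMap,
      LinearMap.comp_id]

/-- **Registered sub-goal G1 `stub_finrank_invariants_tprod_eq_finrank_homWD_dual`** (toward stub
S-17a-B, Henniart 2002 Thm 1.7 (a)): the Weil–Deligne invariants `ker N ⊓ (V ⊗ W)^{W_F}` of
`σ ⊗ τ` have the dimension of `Hom_WD(τ^∨, σ)`; indeed `Θ : V ⊗ W ≃ Hom(W^*, V)` carries the one
onto the other (`ρ_σ(g) ⊗ ρ_τ(g) ↦ (φ ↦ ρ_σ(g) φ ρ_τ^∨(g⁻¹))`, `N_σ ⊗ 1 + 1 ⊗ N_τ ↦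
(φ ↦ N_σ φ - φ N_τ^∨)`). [cite: Deligne1973Constantes, 8.1–8.4] -/
theorem stub_finrank_invariants_tprod_eq_finrank_homWD_dual : ∀ (F : Type) [Field F] [ValuativeRel F] [TopologicalSpace F] [IsNonarchimedeanLocalField F] (hmul : @IsFrobPow.mul F _ _ _ _) (huniq : @IsFrobPow.unique F _ _ _ _) (V : Type) [AddCommGroup V] [Module ℂ V] [FiniteDimensional ℂ V] (W : Type) [AddCommGroup W] [Module ℂ W] [FiniteDimensional ℂ W] (σ : WeilDeligneRep F ℂ V) (τ : WeilDeligneRep F ℂ W), Module.finrank ℂ ↥(LinearMap.ker (σ.tprod τ).N ⊓ (σ.tprod τ).ρ.invariants) = Module.finrank ℂ ↥(homWD (τ.dual hmul huniq) σ) := by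
  intro F _ _ _ _ hmul huniq V _ _ _ W _ _ _ σ τ
  obtain ⟨Θ, hΘ⟩ := exists_tensorEquivHomDual V W
  have hmap := tensorEquivHomDual_map Θ hΘ
  -- monodromy: `Θ (N x) = N_σ ∘ Θ x + Θ x ∘ N_τᵀ`
  have hN : ∀ x, Θ ((σ.tprod τ).N x) = σ.N ∘ₗ Θ x + Θ x ∘ₗ τ.N.dualMap := fun x => by
    rw [WeilDeligneRep.tprod_N, LinearMap.add_apply, map_add, hmap, hmap, Module.End.one_eq_id,
      Module.End.one_eq_id, LinearMap.dualMap_id, LinearMap.comp_id, LinearMap.id_comp]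
  -- Weil group: `Θ (ρ g x) = ρ_σ g ∘ Θ x ∘ ρ_τ(g)ᵀ`
  have hρ : ∀ g x, Θ ((σ.tprod τ).ρ g x) = σ.ρ g ∘ₗ Θ x ∘ₗ (τ.ρ g).dualMap := fun g x => by
    rw [WeilDeligneRep.tprod_ρ_apply, hmap]
  -- the contragredient: `ρ_τ^∨(g) = ρ_τ(g⁻¹)ᵀ`, `N_τ^∨ = -N_τᵀ`
  have hdρ : ∀ g, (τ.dual hmul huniq).ρ g = (τ.ρ g⁻¹).dualMap := fun g => by
    rw [WeilDeligneRep.dual_ρ, Representation.dual_apply, ← LinearMap.dualMap_def]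
  have hiff : ∀ x, x ∈ LinearMap.ker (σ.tprod τ).N ⊓ (σ.tprod τ).ρ.invariants ↔
      Θ x ∈ homWD (τ.dual hmul huniq) σ := fun x => by
    rw [Submodule.mem_inf, LinearMap.mem_ker, Representation.mem_invariants, mem_homWD_iff,
      and_comm]
    refine and_congr (forall_congr' fun g => ?_) ?_
    · rw [← Θ.injective.eq_iff, hρ, hdρ, comp_comp_dualMap_eq_iff]
    · rw [← Θ.map_eq_zero_iff, hN, WeilDeligneRep.dual_N, LinearMap.comp_neg,
        add_eq_zero_iff_eq_neg, eq_comm]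
  have key : (LinearMap.ker (σ.tprod τ).N ⊓ (σ.tprod τ).ρ.invariants).map
      (Θ : V ⊗[ℂ] W →ₗ[ℂ] (Module.Dual ℂ W →ₗ[ℂ] V)) = homWD (τ.dual hmul huniq) σ := by
    ext φ
    rw [Submodule.mem_map_equiv, hiff, LinearEquiv.apply_symm_apply]
  rw [← key, LinearEquiv.finrank_map_eq]

end Summit.Langlands.Langlands.Theorems.ReciprocityUpToIrreducibilityR

end
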